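import Summits.AtomisticToContinuum.BoseEinsteinCondensation.Theses.BECParticleIncrement

/-!
# Birth skeleton — piece `StaticResponseBound` (stmt-AtomisticToContinuum-12322) of the split of `IncrementBound`

Route `BECParticleIncrement`, BC2-redirect of the deciding crux `IncrementBound` (stmt-12320). This file is
the BC3 skeleton of the piece `StaticResponseBound` — the uniform static density-response bound of the
TRUE Dirichlet ground state at every particle number `M ≤ ρ₁L³` of the fixed box, typed as a symmetric
second difference of cosine-sourced ground-state energies,
`2E₀(M) + 2tM ≤ E₀(M;+t,k) + E₀(M;−t,k) + C t² M/(|k|² + ρ_M a)`, i.e. `m₋₁(∑ⱼ cos k·xⱼ) ≲ M · min(1/(ρ_M a), 1/|k|²)`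
— cut at the HEALING SCALE `|k|² ≍ ρ_M a = ξ_M⁻²/(8π)` into the two wavelength regimes that need different tools
(the same cut the leads on the sibling torus crux stmt-12057 use: phonon/crossover line vs kinetic branch):

* `stub_kineticBranch` (XL) — `|k|² ≥ κ ρ_M a` for SOME `κ > 0`: the bound `m₋₁ ≲ M/|k|²`, free-particle
  (recoil) dominated; tools: first-order cancellation in the `±t` sum, localisation of the kinetic energy at
  scales `≫ ξ`, Bogoliubov with external potential in GP boxes (BrenneckeSchleinSchraven2022), the momentum
  distribution tail of the ground state. Fails if the ground state carries `≳ M ρa/k²` particles at momenta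
  `≍ k/2` coherently (degenerate first-order mixing by `cos k·x`).
* `stub_phononBranch` (XL) — `|k|² < κ ρ_M a` for EVERY `κ > 0` (the constant may depend on `κ`): the
  compressibility-type bound `m₋₁ ≲ M/(ρ_M a)`, i.e. the static structure response at long wavelength is
  bounded by the inverse compressibility `≍ 1/(16πa)`; tools: LDA comparison with sourced Lieb–Yngvason /
  Fournais–Solovej energy asymptotics in sub-boxes of side `≫ ξ`, convexity of `e(ρ) ≈ 4πaρ²`. Fails on a soft
  long-wavelength density mode at some `M` (the route's kill criterion 3).

`StaticResponseBound_of : stub_kineticBranch → stub_phononBranch → StaticResponseBound` takes `κ` from the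
kinetic branch, feeds it to the phonon branch, and sets `C := max C₁ C₂`, `ρ₁ := min`, `L₀ := max (max L₁ L₂) 1`
(so that `L > 0` and the error term is monotone in `C`); kernel-checked below, no sorry outside the stubs. The
readable predicate `Body` is definitionally the crux's inner formula (`body_iff` is `Iff.rfl`), so either stub can
be restated verbatim under `Theorems/` without importing this file.
-/

namespace Summit.AtomisticToContinuum.BoseEinsteinCondensation.Cruxes.IncrementBound.Birth.StaticResponse

open MeasureTheory
open scoped ENNReal
open Literature.MathematicalPhysics.QuantumManyBody.BoseGas
open Summit.AtomisticToContinuum.BoseEinsteinCondensation.Theses.BECParticleIncrement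

noncomputable section

/-- The crux's inner formula at `(v, C, L, M, k)`: for all small `t > 0`,
`2E₀(M) + 2tM ≤ E₀(M;+t,k) + E₀(M;−t,k) + C t² M/(‖k‖² + (M/L³) a)` (verbatim the text of
`StaticResponseBound` after its quantifier prefix). -/
def Body (v : ℝ → ℝ≥0∞) (C L : ℝ) (M : ℕ) (k : EuclideanSpace ℝ (Fin 3)) : Prop :=
  ∃ t₀ : ℝ, 0 < t₀ ∧ ∀ t : ℝ, 0 < t → t ≤ t₀ → 2 * Literature.MathematicalPhysics.QuantumManyBody.BoseGas.groundStateEnergy v M L + ENNReal.ofReal (2 * t * (M : ℝ)) ≤ (⨅ Ψ : Literature.MathematicalPhysics.QuantumManyBody.BoseGas.TrialState M L, (Literature.MathematicalPhysics.QuantumManyBody.BoseGas.energy v Ψ + ∫⁻ X, (∑ j : Fin M, ENNReal.ofReal (t * (1 + Real.cos (∑ i : Fin 3, k i * X j i)))) * (‖Ψ.ψ X‖₊ : ENNReal) ^ 2)) + (⨅ Ψ : Literature.MathematicalPhysics.QuantumManyBody.BoseGas.TrialState M L, (Literature.MathematicalPhysics.QuantumManyBody.BoseGas.energy v Ψ +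 ∫⁻ X, (∑ j : Fin M, ENNReal.ofReal (t * (1 - Real.cos (∑ i : Fin 3, k i * X j i)))) * (‖Ψ.ψ X‖₊ : ENNReal) ^ 2)) + ENNReal.ofReal (C * t ^ 2 * (M : ℝ) / (‖k‖ ^ 2 + (M : ℝ) / L ^ 3 * (Literature.MathematicalPhysics.QuantumManyBody.BoseGas.scatteringLength v).toReal))

/-- `StaticResponseBound` is, definitionally, `Body` under its quantifier prefix. -/
theorem staticResponseBound_iff :
    StaticResponseBound ↔ ∀ v : ℝ → ℝ≥0∞, IsRepulsiveFiniteRange v → ∃ C ρ₁ L₀ : ℝ, 0 < ρ₁ ∧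
      ∀ L : ℝ, L₀ ≤ L → ∀ M : ℕ, (M : ℝ) ≤ ρ₁ * L ^ 3 → ∀ k : EuclideanSpace ℝ (Fin 3), k ≠ 0 →
        Body v C L M k :=
  Iff.rfl

/-- The error term is monotone in the constant: `Body v C … → Body v C' …` for `C ≤ C'`, once the
denominator is nonnegative (`0 ≤ L`). -/
theorem body_mono {v : ℝ → ℝ≥0∞} {C C' L : ℝ} {M : ℕ} {k : EuclideanSpace ℝ (Fin 3)}
    (hC : C ≤ C') (hL : 0 ≤ L) (h : Body v C L M k) : Body v C' L M k := by
  obtain ⟨t₀, ht₀, ht⟩ := h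
  refine ⟨t₀, ht₀, fun t h0 h1 => le_trans (ht t h0 h1) ?_⟩
  gcongr _ + _ + ENNReal.ofReal ?_
  have hden : 0 ≤ ‖k‖ ^ 2 + (M : ℝ) / L ^ 3 * (scatteringLength v).toReal := by positivity
  exact div_le_div_of_nonneg_right
    (mul_le_mul_of_nonneg_right (mul_le_mul_of_nonneg_right hC (sq_nonneg t)) (Nat.cast_nonneg M)) hden

/-- **Stub (kinetic branch, XL).** Short wavelengths `|k|² ≥ κ ρ_M a` for some `κ > 0`: the recoil-dominated
bound `m₋₁(∑cos k·xⱼ) ≲ M/|k|²`, uniformly in the dilute fixed Dirichlet box.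
[Stringari1995, PitaevskiiStringari1991 (sum rules), BrenneckeSchleinSchraven2022, LSSY2005] -/
theorem stub_kineticBranch :
    ∀ v : ℝ → ℝ≥0∞, IsRepulsiveFiniteRange v → ∃ κ C ρ₁ L₀ : ℝ, 0 < κ ∧ 0 < ρ₁ ∧
      ∀ L : ℝ, L₀ ≤ L → ∀ M : ℕ, (M : ℝ) ≤ ρ₁ * L ^ 3 → ∀ k : EuclideanSpace ℝ (Fin 3), k ≠ 0 →
        κ * ((M : ℝ) / L ^ 3 * (scatteringLength v).toReal) ≤ ‖k‖ ^ 2 → Body v C L M k := by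
  sorry

/-- **Stub (phonon branch, XL).** Long wavelengths `|k|² < κ ρ_M a`, for every `κ > 0`: the
compressibility-type bound `m₋₁(∑cos k·xⱼ) ≲ M/(ρ_M a)`, uniformly in the dilute fixed Dirichlet box.
[Stringari1995, FournaisSolovej2020, BrenneckeEtAl2024, LSSY2005] -/
theorem stub_phononBranch :
    ∀ v : ℝ → ℝ≥0∞, IsRepulsiveFiniteRange v → ∀ κ : ℝ, 0 < κ → ∃ C ρ₁ L₀ : ℝ, 0 < ρ₁ ∧
      ∀ L : ℝ, L₀ ≤ L → ∀ M : ℕ, (M : ℝ) ≤ ρ₁ * L ^ 3 → ∀ k : EuclideanSpace ℝ (Fin 3), k ≠ 0 →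
        ‖k‖ ^ 2 < κ * ((M : ℝ) / L ^ 3 * (scatteringLength v).toReal) → Body v C L M k := by
  sorry

/-- **Composition (kernel-checked).** Kinetic branch (its own `κ`) and phonon branch (at that `κ`) give the
piece `StaticResponseBound` BY NAME, with `C := max C₁ C₂`, `ρ₁ := min ρa ρb`, `L₀ := max (max La Lb) 1`. -/
theorem StaticResponseBound_of
    (hKin : ∀ v : ℝ → ℝ≥0∞, IsRepulsiveFiniteRange v → ∃ κ C ρ₁ L₀ : ℝ, 0 < κ ∧ 0 < ρ₁ ∧
      ∀ L : ℝ, L₀ ≤ L → ∀ M : ℕ, (M : ℝ) ≤ ρ₁ * L ^ 3 → ∀ k : EuclideanSpace ℝ (Fin 3), k ≠ 0 →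
        κ * ((M : ℝ) / L ^ 3 * (scatteringLength v).toReal) ≤ ‖k‖ ^ 2 → Body v C L M k)
    (hPho : ∀ v : ℝ → ℝ≥0∞, IsRepulsiveFiniteRange v → ∀ κ : ℝ, 0 < κ → ∃ C ρ₁ L₀ : ℝ, 0 < ρ₁ ∧
      ∀ L : ℝ, L₀ ≤ L → ∀ M : ℕ, (M : ℝ) ≤ ρ₁ * L ^ 3 → ∀ k : EuclideanSpace ℝ (Fin 3), k ≠ 0 →
        ‖k‖ ^ 2 < κ * ((M : ℝ) / L ^ 3 * (scatteringLength v).toReal) → Body v C L M k) :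
    StaticResponseBound := by
  rw [staticResponseBound_iff]
  intro v hv
  obtain ⟨κ, C₁, ρa, La, hκ, hρa, hA⟩ := hKin v hv
  obtain ⟨C₂, ρb, Lb, hρb, hB⟩ := hPho v hv κ hκ
  refine ⟨max C₁ C₂, min ρa ρb, max (max La Lb) 1, lt_min hρa hρb, ?_⟩
  intro L hL M hM k hk
  have hLa : La ≤ L := le_trans (le_trans (le_max_left La Lb) (le_max_left _ _)) hL
  have hLb : Lb ≤ L := le_trans (le_trans (le_max_right La Lb) (le_max_left _ _)) hL
  have hL0 : (0 : ℝ) ≤ L := le_trans (le_trans zero_le_one (le_max_right _ 1)) hL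
  have hL3 : (0 : ℝ) ≤ L ^ 3 := pow_nonneg hL0 3
  have hMa : (M : ℝ) ≤ ρa * L ^ 3 := le_trans hM (mul_le_mul_of_nonneg_right (min_le_left _ _) hL3)
  have hMb : (M : ℝ) ≤ ρb * L ^ 3 := le_trans hM (mul_le_mul_of_nonneg_right (min_le_right _ _) hL3)
  by_cases hreg : κ * ((M : ℝ) / L ^ 3 * (scatteringLength v).toReal) ≤ ‖k‖ ^ 2
  · -- kinetic branch
    exact body_mono (le_max_left C₁ C₂) hL0 (hA L hLa M hMa k hk hreg)
  · -- phonon branch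
    push Not at hreg
    exact body_mono (le_max_right C₁ C₂) hL0 (hB L hLb M hMb k hk hreg)

/-- The piece, from the registered stubs. -/
theorem StaticResponseBound_proof : StaticResponseBound :=
  StaticResponseBound_of stub_kineticBranch stub_phononBranch

end

end Summit.AtomisticToContinuum.BoseEinsteinCondensation.Cruxes.IncrementBound.Birth.StaticResponse
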